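/-
Copyright (c) 2026 the pub-hodgecm-mathlib formalisation cell (harness21).  Prover seat hodgecm-mathlib-K2E3-p32 (g0), HCML Track B «K2-LIT» (close-out strike line L4
`stub_StCharTS`), h413 = `stmt-HodgeConjecture-24833`, line `K2_E3_EllipticInputs`, unit U4 «Keys», PART «U4Keys» socket :155 (U4f-χ₁-ram-one-d0B)
`sig_K2E3KeysThmTwoContractingRamifiedCharOneDepthZeroNormTrivial` (LINE-LEAD K2E3-plan (g4) EMIT #5, deal D162, cell «U4-RAM»; plan of record K2E3-p06 (g4) DESIGN-M2-v2 (O2),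
step Z2-B «the type plane in Branch B»), GENERIC part 2: THE NORMALISED `(K, θ)`-TYPE BASIS `(f₁, f_w)` OF `Ind_H^G τ` OVER TWO DOUBLE COSETS BY MACKEY.  2026-09-04.
-/
import Summits.HodgeConjecture.HodgeConjecture.Theorems.K2E3TypeVectorOfSubrep         -- ★ V2 (K2E3-p06 (g4)): `apply_eq_mul_one` (a one-dimensional `τ` acts by the scalar `τ h 1`); brings ★ `Representation.SmoothInd`, ★ `Representation.twist`
import Literature.NumberTheory.Automorphic.SmoothInductionDoubleCosetHom                -- ★ MACKEY-HOM (M3): `exists_intertwiningMap_forall_toFun_eq` (local intertwiners on `H gᵢ K` glue to a `K`-map `E → Ind_H^G σ`)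
import HarnessLib

/-!
# K2 ∕ E3 «EllipticInputs», unit U4 «Keys» — (U4f-χ₁-ram-one-d0B) step Z2-B, generic part 2: THE NORMALISED `(K, θ)`-TYPE BASIS `(f₁, f_w)` OF `Ind_H^G τ`
# over a two-cell decomposition `G = H·K ⊔ H·g₀·K`, from MACKEY — `f_w` EXISTS IFF `θ = τ^{g₀}` ON `K ∩ g₀⁻¹Hg₀` (Branch B, `w₀ ∈ W_χ`)   [Roche1998 §3–§4; Casselman1995 §6.3; BernsteinZelevinsky1977 §2.3]

Cell `pub/hodgecm-mathlib`, crux H413 = `stmt-HodgeConjecture-24833`, route of record `HCCMUnconditional`; chair K2-lead (g2), LINE-LEAD∕dealer K2E3-plan (g4), architect K2E3-p25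
(g3); cell «U4-RAM».  THEOREMS ONLY (no `def`, no `instance`, no `notation`, no named-fact hypothesis, no `sorry`); lane `--supports stmt-HodgeConjecture-24833 --as helper`,
count-neutral.  NOT THE PAYER: the socket :155 stays OPEN.

THE POINT (DESIGN-M2-v2 (O2), K2E3-p06 (g4); PAPER-Z3 §0 «TYPE BASIS»).  ★ `K2E3BranchBDeterminantVanishing.det_intertwiningIntegral_eq_zero_of_typeVector` (this seat) needs a NORMALISED
`(K, θ)`-type basis of `Ind_H^G τ`: sections `f₁, f_w` with `b·f = θ(b) f` (`b ∈ K`), `f₁(1) = 1, f₁(g₀) = 0, f_w(1) = 0, f_w(g₀) = 1` — print: `f₁` supported on `P·I`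
(`f₁(p b) = χδ^{1∕2}(p)χ̃(b)`), `f_w` supported on `P·w₀·I` (`f_w(p w₀ b) = χδ^{1∕2}(p)χ̃(b)`).  THIS FILE constructs them, GENERICALLY, by MACKEY (★ (M3)
`Representation.exists_intertwiningMap_forall_toFun_eq`): a `(K, θ)`-eigen-section is a `K`-map `ℂ_θ → Ind_H^G τ|_K` (`ℂ_θ` = `ℂ` with `K` acting by `θ`, ★ `Representation.twist` of
the trivial line; SMOOTH when `θ = 1` on an open subgroup `C ≤ K` — print: `I₊ ≤ I`, depth zero), and such maps correspond to families of local intertwiners on the cells `H·gᵢ·K`;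
the local intertwiner `1 ↦ 1` at `gᵢ` exists iff `θ(s) = τ(gᵢ s gᵢ⁻¹)` on `S_{gᵢ} = K ∩ gᵢ⁻¹ H gᵢ`, and `0` always does.  So over `G = H·K ⊔ H·g₀·K`: `f₁` ⟸ «`θ = τ` on `K ∩ H`»
(`hθH`; print: `χ̃ = χδ^{1∕2}` on `I ∩ P`, ★ p06 `theta_eq_tau_of_mem`), `f_w` ⟸ «`θ(s) = τ(g₀ s g₀⁻¹)` for `s ∈ K`, `g₀ s g₀⁻¹ ∈ H`» (`hθw`; print: on `I ∩ P̄`, `χ̃(s) = χ₁(s₀₀)`,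
`(χδ^{1∕2})(w₀ s w₀⁻¹) = χ₁(σ(s₀₀)⁻¹)`, equal iff `χ₁(s₀₀·σ s₀₀) = 1` — BRANCH B `hB`).  HYPOTHESES: `K` open; `θ : G → ℂ` multiplicative on `K` with `θ 1 = 1`; an open subgroup `C` with
`θ = 1` on `C`; the cover `G = H·K ∪ H·g₀·K` and `g₀ ∉ H·K`.
* §1 `theta_mul_theta_inv_eq_one` (`θ` is unit-valued on `K`).
* §2 **`exists_typeVector_of_local`** — for ANY prescribed pair of cell values `(c₀, c₁)` with the WEIGHTED local compatibilities `c₀·θ = c₀·τ` on `K ∩ H`, `c₁·θ = c₁·τ^{g₀}` on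
  `K ∩ g₀⁻¹Hg₀`, a `(K, θ)`-type vector `f` with `f(1) = c₀`, `f(g₀) = c₁` (★ (M3) with `E = ℂ_θ` and the local intertwiners `z ↦ cᵢ z`).
* §3 **`exists_typeVector_supported_one`** (`f₁`: `(1, 0)`, needs `hθH` only — every branch), **`exists_typeVector_supported_weyl`** (`f_w`: `(0, 1)`, needs `hθw` — Branch B),
  **`exists_normalised_typeBasis`** — both at once (the `(f₁, f_w)` of PAPER-Z3 §0, the input of ★ `det_intertwiningIntegral_eq_zero_of_typeVector`).
* §4 `cover_two_of_cover_fin_two`, `not_mem_mul_of_disj_fin_two`, **`exists_normalised_typeBasis_of_fin_two`** — the same with the cover ∕ disjointness in the INDEXED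
  two-coset shape of ★ (M3) ∕ ★ `F0P3cStCharTSStLevelsPF.cover_borel_I` ∕ `disj_borel_I` (`U(Φ₃)(L⁺_v) = P·I ⊔ P·w̃·I`), so the CM assembly feeds those ★ theorems verbatim.
HONEST LABEL.  HC_CM is proved only modulo the 7 printed citations (2 remaining named inputs: hLiu418 = `stmt-HodgeConjecture-24832`, h413 = `stmt-HodgeConjecture-24833`) until rung 0
closes; count-neutral — this file does NOT pay the leaf; no printed citation is discharged.  Still untyped for :155: the CM letters `hθw` (⟸ `hB`), `C = I₊`, the cell values and shell
integrals (Z3), the dyadic and ramified places.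

## References
* [Roche1998] A. Roche, *Types and Hecke algebras for principal series representations of split reductive p-adic groups*, Ann. Sci. ÉNS (4) 31 (1998), §3–§4 (`I g I` supports a
  `χ̃`-spherical vector iff `χ̃ = ᵍχ̃` on `J ∩ ᵍJ`).
* [Casselman1995] W. Casselman, *Introduction to the theory of admissible representations of `p`-adic reductive groups* (1995), §3.3, §6.3.
* [BernsteinZelevinsky1977] I. N. Bernstein, A. V. Zelevinsky, Ann. Sci. ÉNS 10 (1977), §2.3 (Mackey theory ∕ the geometric lemma).
* [Bump1997] D. Bump, *Automorphic Forms and Representations* (1997), Exercise 4.5.5 («simple Mackey theory»).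
-/

set_option autoImplicit false
-- the mandated namespace has the single-problem summit's repeated segment (`HodgeConjecture.HodgeConjecture`)
set_option linter.dupNamespace false

noncomputable section

namespace Summit.HodgeConjecture.HodgeConjecture.Cruxes.H413.K2E3IwahoriTypeBasisMackey

open Summit.HodgeConjecture.HodgeConjecture.Cruxes.H413
open Literature.NumberTheory.Automorphic Representation

variable {G : Type*} [Group G] [TopologicalSpace G] [IsTopologicalGroup G] (H : Subgroup G) (τ : Representation ℂ ↥H ℂ)

/-! ## §1 Scalars -/

omit [TopologicalSpace G] [IsTopologicalGroup G] in
/-- A multiplier `θ` multiplicative on `K` with `θ 1 = 1` is unit-valued on `K`: `θ x · θ x⁻¹ = 1`. [folklore] -/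
theorem theta_mul_theta_inv_eq_one (K : Subgroup G) (θ : G → ℂ) (hθmul : ∀ x ∈ K, ∀ y ∈ K, θ (x * y) = θ x * θ y) (hθone : θ 1 = 1)
    {x : G} (hx : x ∈ K) : θ x * θ x⁻¹ = 1 := by
  rw [← hθmul x hx x⁻¹ (K.inv_mem hx), mul_inv_cancel, hθone]

/-! ## §2 One `(K, θ)`-type vector per cell, by Mackey -/

/-- **MACKEY FOR A `(K, θ)`-TYPE VECTOR WITH PRESCRIBED CELL VALUES.**  `K` open; `θ` multiplicative on `K`, `θ 1 = 1`, `θ = 1` on an open `C ≤ K`; `G = H·K ∪ H·g₀·K` with `g₀ ∉ H·K`.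
Given the two LOCAL COMPATIBILITIES weighted by the prescribed values — `c₀ · (θ s − τ s) = 0` for `s ∈ K ∩ H` and `c₁ · (θ s − τ(g₀ s g₀⁻¹)) = 0` for `s ∈ K ∩ g₀⁻¹Hg₀` — there is a
`(K, θ)`-eigen-section `f` of `Ind_H^G τ` with `f(1) = c₀` and `f(g₀) = c₁` (★ (M3) with `E = ℂ_θ`, local intertwiners `z ↦ cᵢ z`). [cite: BernsteinZelevinsky1977, §2.3]
[cite: Roche1998, §3–§4] [cite: Bump1997, Exercise 4.5.5] -/
theorem exists_typeVector_of_local (K : Subgroup G) (hKo : IsOpen (K : Set G)) (θ : G → ℂ)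
    (hθmul : ∀ x ∈ K, ∀ y ∈ K, θ (x * y) = θ x * θ y) (hθone : θ 1 = 1)
    (C : Subgroup G) (hCo : IsOpen (C : Set G)) (hθC : ∀ c ∈ C, θ c = 1)
    (g₀ : G) (hcover : ∀ y : G, (∃ h ∈ H, ∃ b ∈ K, y = h * b) ∨ ∃ h ∈ H, ∃ b ∈ K, y = h * g₀ * b) (hg₀ : ¬ ∃ h ∈ H, ∃ b ∈ K, g₀ = h * b)
    (c₀ c₁ : ℂ)
    (hθH : ∀ (s : G), s ∈ K → ∀ hsH : s ∈ H, c₀ * θ s = c₀ * τ ⟨s, hsH⟩ 1)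
    (hθw : ∀ (s : G), s ∈ K → ∀ hsH : g₀ * s * g₀⁻¹ ∈ H, c₁ * θ s = c₁ * τ ⟨g₀ * s * g₀⁻¹, hsH⟩ 1) :
    ∃ f : Representation.SmoothInd H τ, (∀ x ∈ K, Representation.smoothIndRep H τ x f = θ x • f) ∧ f.toFun 1 = c₀ ∧ f.toFun g₀ = c₁ := by
  classical
  -- `θ` as a character `θK` of `K`, and the line `ℂ_θ` (`E`)
  have hunit : ∀ x : ↥K, θ (x : G) * θ ((x : G))⁻¹ = 1 := fun x => theta_mul_theta_inv_eq_one K θ hθmul hθone x.2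
  let θK : ↥K →* ℂˣ :=
    { toFun := fun x => ⟨θ (x : G), θ ((x : G))⁻¹, hunit x, by rw [mul_comm]; exact hunit x⟩
      map_one' := Units.ext hθone
      map_mul' := fun x y => Units.ext (hθmul x x.2 y y.2) }
  let E : Representation ℂ ↥K ℂ := (Representation.trivial ℂ ↥K ℂ).twist θK
  have hE : ∀ (x : ↥K) (z : ℂ), E x z = θ (x : G) * z := fun x z => by
    simp [E, θK, Representation.twist]
  -- `ℂ_θ` is smooth: `C ≤ K` is open and acts trivially
  have hEs : E.IsSmooth := by
    intro z
    refine Representation.isSmoothVector_of_le E (K := C.subgroupOf K) ?_ (fun x hx => ?_)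
    · rw [Subgroup.coe_subgroupOf]
      exact hCo.preimage continuous_subtype_val
    · rw [Representation.mem_stabilizerSubgroup, hE, hθC _ (Subgroup.mem_subgroupOf.1 hx), one_mul]
  -- the two cells `H·1·K`, `H·g₀·K`
  have hg0 : (![(1 : G), g₀] 0) = 1 := rfl
  have hg1 : (![(1 : G), g₀] 1) = g₀ := rfl
  have hcover' : ∀ y : G, ∃ i : Fin 2, ∃ h : ↥H, ∃ κ ∈ K, y = (h : G) * (![(1 : G), g₀] i) * κ := by
    intro y
    rcases hcover y with ⟨h, hh, b, hb, rfl⟩ | ⟨h, hh, b, hb, rfl⟩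
    · exact ⟨0, ⟨h, hh⟩, b, hb, by rw [hg0, mul_one]⟩
    · exact ⟨1, ⟨h, hh⟩, b, hb, by rw [hg1]⟩
  have hdisj' : ∀ i j : Fin 2, (∃ h : ↥H, ∃ κ ∈ K, (![(1 : G), g₀] j) = (h : G) * (![(1 : G), g₀] i) * κ) → i = j := by
    intro i j hij
    fin_cases i <;> fin_cases j
    · rfl
    · exfalso
      obtain ⟨h, κ, hκ, he⟩ := hij
      refine hg₀ ⟨h, h.2, κ, hκ, ?_⟩
      have he' : g₀ = (h : G) * 1 * κ := he
      rw [he', mul_one]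
    · exfalso
      obtain ⟨h, κ, hκ, he⟩ := hij
      have he' : (1 : G) = (h : G) * g₀ * κ := he
      refine hg₀ ⟨(h : G)⁻¹, H.inv_mem h.2, κ⁻¹, K.inv_mem hκ, ?_⟩
      calc g₀ = (h : G)⁻¹ * ((h : G) * g₀ * κ) * κ⁻¹ := by group
        _ = (h : G)⁻¹ * κ⁻¹ := by rw [← he']; group
    · rfl
  -- the local groups `S_i = K ∩ gᵢ⁻¹ H gᵢ` and local targets `τ^{gᵢ}`
  let ψ : ∀ i : Fin 2, ↥((H.map (MulAut.conj (![(1 : G), g₀] i)⁻¹).toMonoidHom).subgroupOf K) →* ↥H := fun i =>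
    { toFun := fun s => ⟨(![(1 : G), g₀] i) * ((s : ↥K) : G) * (![(1 : G), g₀] i)⁻¹, (Representation.mem_subgroupOf_map_conj_inv_iff H K _ (s : ↥K)).1 s.2⟩
      map_one' := Subtype.ext (by simp)
      map_mul' := fun a b => Subtype.ext (by
        change _ * (((a * b : ↥((H.map (MulAut.conj (![(1 : G), g₀] i)⁻¹).toMonoidHom).subgroupOf K)) : ↥K) : G) * _ =
          (_ * ((a : ↥K) : G) * _) * (_ * ((b : ↥K) : G) * _)
        rw [Subgroup.coe_mul, Subgroup.coe_mul]
        group) }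
  let σc : ∀ i : Fin 2, Representation ℂ ↥((H.map (MulAut.conj (![(1 : G), g₀] i)⁻¹).toMonoidHom).subgroupOf K) ℂ := fun i => τ.comp (ψ i)
  have hσc : ∀ (i : Fin 2) (s : ↥((H.map (MulAut.conj (![(1 : G), g₀] i)⁻¹).toMonoidHom).subgroupOf K)),
      σc i s = τ ⟨(![(1 : G), g₀] i) * ((s : ↥K) : G) * (![(1 : G), g₀] i)⁻¹, (Representation.mem_subgroupOf_map_conj_inv_iff H K _ (s : ↥K)).1 s.2⟩ :=
    fun i s => rfl
  -- the prescribed values and the local compatibilities, cell by cell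
  let c : Fin 2 → ℂ := ![c₀, c₁]
  have hc : ∀ (i : Fin 2) (s : ↥K) (hsH : (![(1 : G), g₀] i) * (s : G) * (![(1 : G), g₀] i)⁻¹ ∈ H),
      c i * θ (s : G) = c i * τ ⟨(![(1 : G), g₀] i) * (s : G) * (![(1 : G), g₀] i)⁻¹, hsH⟩ 1 := by
    intro i s hsH
    match i, hsH with
    | 0, hsH =>
      have hsH' : (s : G) ∈ H := by simpa using hsH
      have heq : τ (⟨(![(1 : G), g₀] 0) * (s : G) * (![(1 : G), g₀] 0)⁻¹, hsH⟩ : ↥H) = τ ⟨(s : G), hsH'⟩ := by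
        congr 1; exact Subtype.ext (by simp)
      show c₀ * θ (s : G) = c₀ * τ (⟨(![(1 : G), g₀] 0) * (s : G) * (![(1 : G), g₀] 0)⁻¹, hsH⟩ : ↥H) 1
      rw [heq]
      exact hθH s s.2 hsH'
    | 1, hsH => exact hθw s s.2 hsH
  -- the local intertwiners `z ↦ cᵢ z`
  have hφ : ∀ (i : Fin 2) (s : ↥((H.map (MulAut.conj (![(1 : G), g₀] i)⁻¹).toMonoidHom).subgroupOf K)) (z : ℂ),
      (c i • (LinearMap.id : ℂ →ₗ[ℂ] ℂ)) ((E.comp ((H.map (MulAut.conj (![(1 : G), g₀] i)⁻¹).toMonoidHom).subgroupOf K).subtype) s z) =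
        σc i s ((c i • (LinearMap.id : ℂ →ₗ[ℂ] ℂ)) z) := by
    intro i s z
    rw [hσc i s, LinearMap.smul_apply, LinearMap.smul_apply, LinearMap.id_apply, LinearMap.id_apply, smul_eq_mul, smul_eq_mul, MonoidHom.comp_apply,
      Subgroup.coe_subtype, hE, K2E3TypeVectorOfSubrep.apply_eq_mul_one H τ _ (c i * z)]
    have h := hc i (s : ↥K) ((Representation.mem_subgroupOf_map_conj_inv_iff H K _ (s : ↥K)).1 s.2)
    calc c i * (θ ((s : ↥K) : G) * z) = (c i * θ ((s : ↥K) : G)) * z := by ring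
      _ = (c i * τ ⟨(![(1 : G), g₀] i) * ((s : ↥K) : G) * (![(1 : G), g₀] i)⁻¹, (Representation.mem_subgroupOf_map_conj_inv_iff H K _ (s : ↥K)).1 s.2⟩ 1) * z := by
          rw [h]
      _ = _ := by ring
  let φ : ∀ i : Fin 2, IntertwiningMap (E.comp ((H.map (MulAut.conj (![(1 : G), g₀] i)⁻¹).toMonoidHom).subgroupOf K).subtype) (σc i) := fun i =>
    LinearMap.intertwiningMap_of_isIntertwiningMap _ _ (c i • (LinearMap.id : ℂ →ₗ[ℂ] ℂ)) (hφ i)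
  have hφapply : ∀ (i : Fin 2) (z : ℂ), φ i z = c i * z := fun i z => rfl
  -- MACKEY (M3)
  obtain ⟨Φ, hΦ, -⟩ := Representation.exists_intertwiningMap_forall_toFun_eq (H := H) (K := K) (σ := τ) (τ := E) hKo hEs hcover' hdisj' σc hσc φ
  refine ⟨Φ 1, fun x hx => ?_, ?_, ?_⟩
  · -- `(K, θ)`-eigen
    have h := IntertwiningMap.isIntertwining _ _ Φ (⟨x, hx⟩ : ↥K) (1 : ℂ)
    rw [MonoidHom.comp_apply, Subgroup.coe_subtype, hE, mul_one] at h
    rw [← h, show (θ x : ℂ) = θ x • (1 : ℂ) by rw [smul_eq_mul, mul_one], map_smul, smul_eq_mul, mul_one]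
  · rw [← hg0, hΦ 0 1, hφapply]
    show c₀ * 1 = c₀
    rw [mul_one]
  · rw [← hg1, hΦ 1 1, hφapply]
    show c₁ * 1 = c₁
    rw [mul_one]

/-! ## §3 The type vector on each cell; the normalised type basis -/

/-- **`f₁`: THE `(K, θ)`-TYPE VECTOR SUPPORTED ON `H·K`** (`f₁(1) = 1`, `f₁(g₀) = 0`), which exists in EVERY branch: only the compatibility `θ = τ` on `K ∩ H` is needed (print: `χ̃ = χδ^{1∕2}` on
`I ∩ P`, ★ p06 `theta_eq_tau_of_mem`). [cite: Roche1998, §3–§4] [cite: Casselman1995, §6.3] -/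
theorem exists_typeVector_supported_one (K : Subgroup G) (hKo : IsOpen (K : Set G)) (θ : G → ℂ)
    (hθmul : ∀ x ∈ K, ∀ y ∈ K, θ (x * y) = θ x * θ y) (hθone : θ 1 = 1)
    (C : Subgroup G) (hCo : IsOpen (C : Set G)) (hθC : ∀ c ∈ C, θ c = 1)
    (g₀ : G) (hcover : ∀ y : G, (∃ h ∈ H, ∃ b ∈ K, y = h * b) ∨ ∃ h ∈ H, ∃ b ∈ K, y = h * g₀ * b) (hg₀ : ¬ ∃ h ∈ H, ∃ b ∈ K, g₀ = h * b)
    (hθH : ∀ (s : G), s ∈ K → ∀ hsH : s ∈ H, θ s = τ ⟨s, hsH⟩ 1) :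
    ∃ f₁ : Representation.SmoothInd H τ, (∀ x ∈ K, Representation.smoothIndRep H τ x f₁ = θ x • f₁) ∧ f₁.toFun 1 = 1 ∧ f₁.toFun g₀ = 0 :=
  exists_typeVector_of_local H τ K hKo θ hθmul hθone C hCo hθC g₀ hcover hg₀ 1 0 (fun s hs hsH => by rw [hθH s hs hsH])
    (fun _ _ _ => by rw [zero_mul, zero_mul])

/-- **`f_w`: THE `(K, θ)`-TYPE VECTOR SUPPORTED ON `H·g₀·K`** (`f_w(1) = 0`, `f_w(g₀) = 1`), which exists iff `θ(s) = τ(g₀ s g₀⁻¹)` on `K ∩ g₀⁻¹ H g₀` — BRANCH B (`w₀ ∈ W_χ`; print: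
`χ̃(s) = χ₁(s₀₀) = χ₁(σ(s₀₀)⁻¹)` on `I ∩ P̄`, i.e. `χ₁(u·σu) = 1` on units, the leaf's `hB`). [cite: Roche1998, §3–§4] [cite: Casselman1995, §6.3] [cite: Keys1984, §7 Theorem (2) p. 126] -/
theorem exists_typeVector_supported_weyl (K : Subgroup G) (hKo : IsOpen (K : Set G)) (θ : G → ℂ)
    (hθmul : ∀ x ∈ K, ∀ y ∈ K, θ (x * y) = θ x * θ y) (hθone : θ 1 = 1)
    (C : Subgroup G) (hCo : IsOpen (C : Set G)) (hθC : ∀ c ∈ C, θ c = 1)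
    (g₀ : G) (hcover : ∀ y : G, (∃ h ∈ H, ∃ b ∈ K, y = h * b) ∨ ∃ h ∈ H, ∃ b ∈ K, y = h * g₀ * b) (hg₀ : ¬ ∃ h ∈ H, ∃ b ∈ K, g₀ = h * b)
    (hθw : ∀ (s : G), s ∈ K → ∀ hsH : g₀ * s * g₀⁻¹ ∈ H, θ s = τ ⟨g₀ * s * g₀⁻¹, hsH⟩ 1) :
    ∃ f_w : Representation.SmoothInd H τ, (∀ x ∈ K, Representation.smoothIndRep H τ x f_w = θ x • f_w) ∧ f_w.toFun 1 = 0 ∧ f_w.toFun g₀ = 1 :=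
  exists_typeVector_of_local H τ K hKo θ hθmul hθone C hCo hθC g₀ hcover hg₀ 0 1 (fun _ _ _ => by rw [zero_mul, zero_mul])
    (fun s hs hsH => by rw [hθw s hs hsH])

/-- **THE NORMALISED `(K, θ)`-TYPE BASIS `(f₁, f_w)` IN BRANCH B** — `f₁(1) = 1, f₁(g₀) = 0, f_w(1) = 0, f_w(g₀) = 1`, both `(K, θ)`-eigen; with ★ Z2 `eq_of_eigen_of_apply_eq` every
`(K, θ)`-type vector is `f(1)·f₁ + f(g₀)·f_w` (★ `K2E3BranchBDeterminantVanishing.eq_smul_add_smul_of_eigen`), so the type plane IS `ℂf₁ ⊕ ℂf_w` (print PAPER-Z3 §0: `|W_χ| = 2`).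
[cite: Roche1998, §3–§4] [cite: Casselman1995, §6.3] [cite: BernsteinZelevinsky1977, §2.3] -/
theorem exists_normalised_typeBasis (K : Subgroup G) (hKo : IsOpen (K : Set G)) (θ : G → ℂ)
    (hθmul : ∀ x ∈ K, ∀ y ∈ K, θ (x * y) = θ x * θ y) (hθone : θ 1 = 1)
    (C : Subgroup G) (hCo : IsOpen (C : Set G)) (hθC : ∀ c ∈ C, θ c = 1)
    (g₀ : G) (hcover : ∀ y : G, (∃ h ∈ H, ∃ b ∈ K, y = h * b) ∨ ∃ h ∈ H, ∃ b ∈ K, y = h * g₀ * b) (hg₀ : ¬ ∃ h ∈ H, ∃ b ∈ K, g₀ = h * b)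
    (hθH : ∀ (s : G), s ∈ K → ∀ hsH : s ∈ H, θ s = τ ⟨s, hsH⟩ 1)
    (hθw : ∀ (s : G), s ∈ K → ∀ hsH : g₀ * s * g₀⁻¹ ∈ H, θ s = τ ⟨g₀ * s * g₀⁻¹, hsH⟩ 1) :
    ∃ f₁ f_w : Representation.SmoothInd H τ,
      (∀ x ∈ K, Representation.smoothIndRep H τ x f₁ = θ x • f₁) ∧ (∀ x ∈ K, Representation.smoothIndRep H τ x f_w = θ x • f_w) ∧
      f₁.toFun 1 = 1 ∧ f₁.toFun g₀ = 0 ∧ f_w.toFun 1 = 0 ∧ f_w.toFun g₀ = 1 := by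
  obtain ⟨f₁, h₁, h11, h1g⟩ := exists_typeVector_supported_one H τ K hKo θ hθmul hθone C hCo hθC g₀ hcover hg₀ hθH
  obtain ⟨f_w, hw, hw1, hwg⟩ := exists_typeVector_supported_weyl H τ K hKo θ hθmul hθone C hCo hθC g₀ hcover hg₀ hθw
  exact ⟨f₁, f_w, h₁, hw, h11, h1g, hw1, hwg⟩

/-! ## §4 The dictionary with the indexed two-coset shape of ★ MACKEY ∕ ★ `cover_borel_I`, `disj_borel_I` -/

omit [TopologicalSpace G] [IsTopologicalGroup G] in
/-- The INDEXED cover `∀ y, ∃ i : Fin 2, ∃ h : ↥H, ∃ κ ∈ K, y = h · ![1, g₀] i · κ` (the shape of ★ (M3) and of ★ `F0P3cStCharTSStLevelsPF.cover_borel_I` for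
`U(Φ₃)(L⁺_v) = P·I ⊔ P·w̃·I`) gives the two-case cover used in §2–§3. [cite: BruhatTits1972, (4.4.4)] [cite: Casselman1995, §6.3] -/
theorem cover_two_of_cover_fin_two (K : Subgroup G) (g₀ : G)
    (hcover' : ∀ y : G, ∃ i : Fin 2, ∃ h : ↥H, ∃ κ ∈ K, y = (h : G) * (![(1 : G), g₀] i) * κ) :
    ∀ y : G, (∃ h ∈ H, ∃ b ∈ K, y = h * b) ∨ ∃ h ∈ H, ∃ b ∈ K, y = h * g₀ * b := by
  intro y
  obtain ⟨i, h, κ, hκ, hy⟩ := hcover' y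
  match i, hy with
  | 0, hy => exact Or.inl ⟨h, h.2, κ, hκ, by rw [hy]; exact congrArg (· * κ) (mul_one (h : G))⟩
  | 1, hy => exact Or.inr ⟨h, h.2, κ, hκ, hy⟩

omit [TopologicalSpace G] [IsTopologicalGroup G] in
/-- The INDEXED disjointness `(∃ h κ, ![1, g₀] j = h · ![1, g₀] i · κ) → i = j` (the shape of ★ (M3) and of ★ `F0P3cStCharTSStLevelsPF.disj_borel_I`) gives `g₀ ∉ H·K`.
[cite: BruhatTits1972, (4.4.4)] [cite: Casselman1995, §6.3] -/
theorem not_mem_mul_of_disj_fin_two (K : Subgroup G) (g₀ : G)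
    (hdisj' : ∀ i j : Fin 2, (∃ h : ↥H, ∃ κ ∈ K, (![(1 : G), g₀] j) = (h : G) * (![(1 : G), g₀] i) * κ) → i = j) :
    ¬ ∃ h ∈ H, ∃ b ∈ K, g₀ = h * b := by
  rintro ⟨h, hh, b, hb, he⟩
  have h01 : (0 : Fin 2) = 1 := hdisj' 0 1 ⟨⟨h, hh⟩, b, hb, by rw [he]; exact (congrArg (· * b) (mul_one h)).symm⟩
  exact absurd h01 (by decide)

/-- **THE NORMALISED `(K, θ)`-TYPE BASIS, INDEXED-COSET FORM** — `exists_normalised_typeBasis` with the cover and disjointness in the shape of ★ (M3) ∕ ★ `cover_borel_I` ∕ ★ `disj_borel_I`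
(so the `U(Φ₃)(L⁺_v)` assembly feeds those theorems verbatim, with `g₀ = w̃ = eA⁻¹ w₀`). [cite: Roche1998, §3–§4] [cite: Casselman1995, §6.3] [cite: BernsteinZelevinsky1977, §2.3] -/
theorem exists_normalised_typeBasis_of_fin_two (K : Subgroup G) (hKo : IsOpen (K : Set G)) (θ : G → ℂ)
    (hθmul : ∀ x ∈ K, ∀ y ∈ K, θ (x * y) = θ x * θ y) (hθone : θ 1 = 1)
    (C : Subgroup G) (hCo : IsOpen (C : Set G)) (hθC : ∀ c ∈ C, θ c = 1) (g₀ : G)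
    (hcover' : ∀ y : G, ∃ i : Fin 2, ∃ h : ↥H, ∃ κ ∈ K, y = (h : G) * (![(1 : G), g₀] i) * κ)
    (hdisj' : ∀ i j : Fin 2, (∃ h : ↥H, ∃ κ ∈ K, (![(1 : G), g₀] j) = (h : G) * (![(1 : G), g₀] i) * κ) → i = j)
    (hθH : ∀ (s : G), s ∈ K → ∀ hsH : s ∈ H, θ s = τ ⟨s, hsH⟩ 1)
    (hθw : ∀ (s : G), s ∈ K → ∀ hsH : g₀ * s * g₀⁻¹ ∈ H, θ s = τ ⟨g₀ * s * g₀⁻¹, hsH⟩ 1) :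
    ∃ f₁ f_w : Representation.SmoothInd H τ,
      (∀ x ∈ K, Representation.smoothIndRep H τ x f₁ = θ x • f₁) ∧ (∀ x ∈ K, Representation.smoothIndRep H τ x f_w = θ x • f_w) ∧
      f₁.toFun 1 = 1 ∧ f₁.toFun g₀ = 0 ∧ f_w.toFun 1 = 0 ∧ f_w.toFun g₀ = 1 :=
  exists_normalised_typeBasis H τ K hKo θ hθmul hθone C hCo hθC g₀ (cover_two_of_cover_fin_two H K g₀ hcover') (not_mem_mul_of_disj_fin_two H K g₀ hdisj') hθH hθw

end Summit.HodgeConjecture.HodgeConjecture.Cruxes.H413.K2E3IwahoriTypeBasisMackey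

end
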